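import Summits.CriticalPhenomena.PercolationContinuityZ3.Theorems.PercNearOneGluingNoHeavyLowerTailKnQuestion8CoefficientwiseCoreClassKernelMixHubFinal
import Mathlib.Data.Nat.Find
import HarnessLib

/-!
# The augmented staircase theorem from natural data (PATH LEMMA of hub-Kleitman, layer 5)

Support file (`--supports stmt-CriticalPhenomena-4575`, closed), prover `prim-cplus-coupling` (gen 51).  No definitions, no notations,
no named facts, no sorries; standard axioms.  Memo `prim-cplus-coupling/A5-COUPLING-gen51.md` §2, §7(1).

`…KernelMixHubFinal.hubStair_matching` takes its data in 'hypothesis style' (row/column extents of `A`, `B`, the staircase, the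
diagonal/domino extents).  `hubStair_data` derives all of it from the NATURAL data of the memo's class 𝒞₀: column tops `om`
of the staircase (`x+1 ≤ om x ≤ N`, nondecreasing), a cell set `A` that is down-closed, a cell set `B` that is up-closed, both
inside the staircase; the derived functions are `Nat.findGreatest` expressions.  (The resulting clean statement,
`hubStair_matching_closed`, is the next file `…KernelMixHubClosed`.)
[cite: KozmaNitzan2024, Questions 8–9 (§5.5 p. 36) (context)]
-/

namespace Summit.CriticalPhenomena.PercolationContinuityZ3.Theorems

open Finset
open scoped symmDiff

namespace Coefficientwise

/-- **Derived data.**  From natural 𝒞₀ data (staircase column tops `om`; down-closed `A`, up-closed `B` inside the staircase)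
all hypothesis-style data of `hubStair_matching` exist. [folklore] -/
theorem hubStair_data (N : ℕ) (hN : 2 ≤ N) (om : ℕ → ℕ) (A B : Finset (ℕ × ℕ))
    (hom : ∀ x, 1 ≤ x → x ≤ N - 1 → x + 1 ≤ om x ∧ om x ≤ N)
    (hmono : ∀ x y, 1 ≤ x → x ≤ y → y ≤ N - 1 → om x ≤ om y)
    (hAcell : ∀ c ∈ A, 1 ≤ c.1 ∧ c.1 ≤ c.2 ∧ c.2 ≤ N - 1 ∧ c.2 ≤ om c.1)
    (hAdown : ∀ c ∈ A, ∀ x y, 1 ≤ x → x ≤ c.1 → x ≤ y → y ≤ c.2 → (x, y) ∈ A)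
    (hBcell : ∀ c ∈ B, 1 ≤ c.1 ∧ c.1 ≤ c.2 ∧ c.2 ≤ N - 1 ∧ c.2 ≤ om c.1)
    (hBup : ∀ c ∈ B, ∀ x y, c.1 ≤ x → c.2 ≤ y → x ≤ y → y ≤ N - 1 → (x, y) ∈ B) :
    ∃ (xi alpha alphaP beta betaP : ℕ → ℕ) (sA dA bd db : ℕ),
      (∀ y, 1 ≤ y → y ≤ N - 1 → 1 ≤ xi y ∧ xi y ≤ y) ∧
      (∀ y, 2 ≤ y → y ≤ N - 1 → xi y ≤ y - 1) ∧
      (∀ x y, 1 ≤ x → x ≤ y → y ≤ N - 1 → (xi y ≤ x ↔ y ≤ om x)) ∧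
      (∀ x y, (x, y) ∈ A ↔ 1 ≤ x ∧ x ≤ y ∧ y ≤ N - 1 ∧ x ≤ alpha y) ∧
      (∀ x y, (x, y) ∈ A ↔ 1 ≤ x ∧ x ≤ y ∧ y ≤ N - 1 ∧ y ≤ alphaP x) ∧
      (∀ x y, (x, y) ∈ A → xi y ≤ x) ∧
      (∀ x, (x, x) ∈ A ↔ 1 ≤ x ∧ x ≤ sA) ∧
      (∀ x, (x, x + 1) ∈ A ↔ 1 ≤ x ∧ x ≤ dA) ∧
      (dA ≤ sA ∧ sA ≤ dA + 1) ∧ sA ≤ N - 1 ∧ dA + 1 ≤ N - 1 ∧ (∀ x, alphaP x ≤ N - 1) ∧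
      (∀ x y, (x, y) ∈ B ↔ 1 ≤ x ∧ x ≤ y ∧ y ≤ N - 1 ∧ beta y ≤ x) ∧
      (∀ x y, (x, y) ∈ B ↔ 1 ≤ x ∧ x ≤ y ∧ y ≤ N - 1 ∧ betaP x ≤ y) ∧
      (∀ x y, (x, y) ∈ B → xi y ≤ x) ∧
      (∀ x, (x, x) ∈ B ↔ 1 ≤ x ∧ bd ≤ x ∧ x ≤ N - 1) ∧
      (∀ x, (x, x + 1) ∈ B ↔ 1 ≤ x ∧ db ≤ x ∧ x + 1 ≤ N - 1) ∧
      (db ≤ bd ∧ bd ≤ db + 1) ∧ 1 ≤ db ∧ db ≤ N - 1 ∧ bd ≤ N ∧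
      (∀ y, 1 ≤ beta y) ∧ (∀ x, 1 ≤ x → x ≤ N - 1 → x ≤ betaP x ∧ betaP x ≤ N) := by
  classical
  have hN1 : 1 ≤ N - 1 := by omega
  -- the derived data (opaque names with defining equations)
  obtain ⟨xi, hxi⟩ : ∃ f : ℕ → ℕ, ∀ y, f y = Nat.findGreatest (fun x => om x < y) (N - 1) + 1 := ⟨_, fun _ => rfl⟩
  obtain ⟨alpha, halpha⟩ : ∃ f : ℕ → ℕ, ∀ y, f y = Nat.findGreatest (fun x => (x, y) ∈ A) (N - 1) := ⟨_, fun _ => rfl⟩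
  obtain ⟨alphaP, halphaP⟩ : ∃ f : ℕ → ℕ, ∀ x, f x = Nat.findGreatest (fun y => (x, y) ∈ A) (N - 1) :=
    ⟨_, fun _ => rfl⟩
  obtain ⟨beta, hbeta⟩ : ∃ f : ℕ → ℕ, ∀ y, f y = Nat.findGreatest (fun x => (x, y) ∉ B) y + 1 := ⟨_, fun _ => rfl⟩
  obtain ⟨betaP, hbetaP⟩ : ∃ f : ℕ → ℕ, ∀ x, f x = Nat.findGreatest (fun y => (x, y) ∉ B) (N - 1) + 1 :=
    ⟨_, fun _ => rfl⟩
  obtain ⟨sA, hsA⟩ : ∃ s : ℕ, s = Nat.findGreatest (fun x => (x, x) ∈ A) (N - 1) := ⟨_, rfl⟩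
  obtain ⟨dA, hdA⟩ : ∃ s : ℕ, s = Nat.findGreatest (fun x => (x, x + 1) ∈ A) (N - 1) := ⟨_, rfl⟩
  obtain ⟨gd, hgd⟩ : ∃ s : ℕ, s = Nat.findGreatest (fun x => (x, x) ∉ B) (N - 1) := ⟨_, rfl⟩
  obtain ⟨gm, hgm⟩ : ∃ s : ℕ, s = Nat.findGreatest (fun x => (x, x + 1) ∉ B) (N - 2) := ⟨_, rfl⟩
  refine ⟨xi, alpha, alphaP, beta, betaP, sA, dA, gd + 1, gm + 1, ?_⟩
  -- (W1) the staircase rows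
  have hXI : ∀ x y, 1 ≤ x → x ≤ y → y ≤ N - 1 → (xi y ≤ x ↔ y ≤ om x) := by
    intro x y hx hxy hy
    rw [hxi]
    constructor
    · intro h
      have hk : ¬ (om x < y) :=
        Nat.findGreatest_is_greatest (P := fun x => om x < y) (n := N - 1) (by omega) (by omega)
      omega
    · intro h
      by_contra hc
      push Not at hc
      set g := Nat.findGreatest (fun x => om x < y) (N - 1) with hg
      have hgx : x ≤ g := by omega
      have hg0 : g ≠ 0 := by omega
      have hPg : om g < y := Nat.findGreatest_of_ne_zero (P := fun x => om x < y) hg.symm hg0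
      have hgle : g ≤ N - 1 := Nat.findGreatest_le _
      have := hmono x g hx hgx hgle
      omega
  have hXIle : ∀ y, 1 ≤ y → y ≤ N - 1 → xi y ≤ y := by
    intro y hy1 hyN
    rw [hxi]
    by_contra hc
    push Not at hc
    set g := Nat.findGreatest (fun x => om x < y) (N - 1) with hg
    have hg0 : g ≠ 0 := by omega
    have hPg : om g < y := Nat.findGreatest_of_ne_zero (P := fun x => om x < y) hg.symm hg0
    have hgle : g ≤ N - 1 := Nat.findGreatest_le _
    have := (hom g (by omega) hgle).1
    omega
  refine ⟨fun y hy1 hyN => ⟨by rw [hxi]; omega, hXIle y hy1 hyN⟩, ?_, hXI, ?_, ?_, ?_, ?_, ?_, ?_, ?_, ?_, ?_, ?_, ?_, ?_, ?_, ?_, ?_,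
    ?_, ?_, ?_, ?_, ?_⟩
  · -- hxi2
    intro y hy2 hyN
    have hgy := hXIle y (by omega) hyN
    rw [hxi] at hgy ⊢
    by_contra hc
    push Not at hc
    set g := Nat.findGreatest (fun x => om x < y) (N - 1) with hg
    have hgeq : g = y - 1 := by omega
    have hg0 : g ≠ 0 := by omega
    have hPg : om g < y := Nat.findGreatest_of_ne_zero (P := fun x => om x < y) hg.symm hg0
    have := (hom (y - 1) (by omega) (by omega)).1
    rw [hgeq] at hPg
    omega
  · -- hArow
    intro x y
    constructor
    · intro hxy
      have hc := hAcell _ hxy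
      simp only at hc
      refine ⟨hc.1, hc.2.1, hc.2.2.1, ?_⟩
      rw [halpha]
      exact Nat.le_findGreatest (P := fun x => (x, y) ∈ A) (by omega) hxy
    · rintro ⟨hx1, hxy, hyN, hxa⟩
      rw [halpha] at hxa
      set g := Nat.findGreatest (fun x => (x, y) ∈ A) (N - 1) with hg
      have hg0 : g ≠ 0 := by omega
      have hPg : (g, y) ∈ A := Nat.findGreatest_of_ne_zero (P := fun x => (x, y) ∈ A) hg.symm hg0
      exact hAdown _ hPg x y hx1 hxa hxy (le_refl _)
  · -- hAcol
    intro x y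
    constructor
    · intro hxy
      have hc := hAcell _ hxy
      simp only at hc
      refine ⟨hc.1, hc.2.1, hc.2.2.1, ?_⟩
      rw [halphaP]
      exact Nat.le_findGreatest (P := fun y => (x, y) ∈ A) hc.2.2.1 hxy
    · rintro ⟨hx1, hxy, hyN, hya⟩
      rw [halphaP] at hya
      set g := Nat.findGreatest (fun y => (x, y) ∈ A) (N - 1) with hg
      have hg0 : g ≠ 0 := by omega
      have hPg : (x, g) ∈ A := Nat.findGreatest_of_ne_zero (P := fun y => (x, y) ∈ A) hg.symm hg0
      exact hAdown _ hPg x y hx1 (le_refl _) hxy hya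
  · -- hAR
    intro x y hxy
    have hc := hAcell _ hxy
    simp only at hc
    exact (hXI x y hc.1 hc.2.1 hc.2.2.1).mpr hc.2.2.2
  · -- hAdiag
    intro x
    constructor
    · intro hxx
      have hc := hAcell _ hxx
      refine ⟨hc.1, ?_⟩
      rw [hsA]
      exact Nat.le_findGreatest (P := fun x => (x, x) ∈ A) hc.2.2.1 hxx
    · rintro ⟨hx1, hxs⟩
      rw [hsA] at hxs
      set g := Nat.findGreatest (fun x => (x, x) ∈ A) (N - 1) with hg
      have hg0 : g ≠ 0 := by omega
      have hPg : (g, g) ∈ A := Nat.findGreatest_of_ne_zero (P := fun x => (x, x) ∈ A) hg.symm hg0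
      exact hAdown _ hPg x x hx1 hxs (le_refl _) hxs
  · -- hAdom
    intro x
    constructor
    · intro hxx
      have hc := hAcell _ hxx
      simp only at hc
      refine ⟨hc.1, ?_⟩
      rw [hdA]
      exact Nat.le_findGreatest (P := fun x => (x, x + 1) ∈ A) (by omega) hxx
    · rintro ⟨hx1, hxd⟩
      rw [hdA] at hxd
      set g := Nat.findGreatest (fun x => (x, x + 1) ∈ A) (N - 1) with hg
      have hg0 : g ≠ 0 := by omega
      have hPg : (g, g + 1) ∈ A := Nat.findGreatest_of_ne_zero (P := fun x => (x, x + 1) ∈ A) hg.symm hg0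
      exact hAdown _ hPg x (x + 1) hx1 hxd (by omega) (by omega)
  · -- hsd : dA ≤ sA ∧ sA ≤ dA + 1
    constructor
    · by_cases hd0 : dA = 0
      · omega
      · have hPd : (dA, dA + 1) ∈ A := Nat.findGreatest_of_ne_zero (P := fun x => (x, x + 1) ∈ A) hdA.symm hd0
        have hc := hAcell _ hPd
        simp only at hc
        have hdd : (dA, dA) ∈ A := hAdown _ hPd dA dA hc.1 (le_refl _) (le_refl _) (by omega)
        rw [hsA]
        exact Nat.le_findGreatest (P := fun x => (x, x) ∈ A) (by omega) hdd
    · by_cases hs1 : sA ≤ 1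
      · omega
      · have hs0 : sA ≠ 0 := by omega
        have hPs : (sA, sA) ∈ A := Nat.findGreatest_of_ne_zero (P := fun x => (x, x) ∈ A) hsA.symm hs0
        have hc := hAcell _ hPs
        simp only at hc
        have h' : (sA - 1, sA - 1 + 1) ∈ A := by
          have e : sA - 1 + 1 = sA := by omega
          rw [e]
          exact hAdown _ hPs (sA - 1) sA (by omega) (by omega) (by omega) (le_refl _)
        have := Nat.le_findGreatest (P := fun x => (x, x + 1) ∈ A) (by omega : sA - 1 ≤ N - 1) h'
        rw [hdA]
        omega
  · rw [hsA]; exact Nat.findGreatest_le _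
  · -- hdN : dA + 1 ≤ N - 1
    by_cases hd0 : dA = 0
    · omega
    · have hPd : (dA, dA + 1) ∈ A := Nat.findGreatest_of_ne_zero (P := fun x => (x, x + 1) ∈ A) hdA.symm hd0
      have hc := hAcell _ hPd
      simp only at hc
      exact hc.2.2.1
  · intro x; rw [halphaP]; exact Nat.findGreatest_le _
  · -- hBrow
    intro x y
    constructor
    · intro hxy
      have hc := hBcell _ hxy
      simp only at hc
      refine ⟨hc.1, hc.2.1, hc.2.2.1, ?_⟩
      rw [hbeta]
      by_contra hlt
      push Not at hlt
      set g := Nat.findGreatest (fun x => (x, y) ∉ B) y with hg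
      have hg0 : g ≠ 0 := by omega
      have hPg : (g, y) ∉ B := Nat.findGreatest_of_ne_zero (P := fun x => (x, y) ∉ B) hg.symm hg0
      have hgy : g ≤ y := Nat.findGreatest_le _
      exact hPg (hBup _ hxy g y (by omega) (le_refl _) hgy hc.2.2.1)
    · rintro ⟨hx1, hxy, hyN, hbx⟩
      rw [hbeta] at hbx
      by_contra hnot
      have := Nat.le_findGreatest (P := fun x => (x, y) ∉ B) hxy hnot
      omega
  · -- hBcol
    intro x y
    constructor
    · intro hxy
      have hc := hBcell _ hxy
      simp only at hc
      refine ⟨hc.1, hc.2.1, hc.2.2.1, ?_⟩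
      rw [hbetaP]
      by_contra hlt
      push Not at hlt
      set g := Nat.findGreatest (fun y => (x, y) ∉ B) (N - 1) with hg
      have hg0 : g ≠ 0 := by omega
      have hPg : (x, g) ∉ B := Nat.findGreatest_of_ne_zero (P := fun y => (x, y) ∉ B) hg.symm hg0
      have hgN : g ≤ N - 1 := Nat.findGreatest_le _
      exact hPg (hBup _ hxy x g (le_refl _) (by omega) (by omega) hgN)
    · rintro ⟨hx1, hxy, hyN, hbx⟩
      rw [hbetaP] at hbx
      by_contra hnot
      have := Nat.le_findGreatest (P := fun y => (x, y) ∉ B) hyN hnot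
      omega
  · -- hBR
    intro x y hxy
    have hc := hBcell _ hxy
    simp only at hc
    exact (hXI x y hc.1 hc.2.1 hc.2.2.1).mpr hc.2.2.2
  · -- hBdiag
    intro x
    constructor
    · intro hxx
      have hc := hBcell _ hxx
      simp only at hc
      refine ⟨hc.1, ?_, hc.2.2.1⟩
      by_contra hlt
      push Not at hlt
      have hg0 : gd ≠ 0 := by omega
      have hPg : (gd, gd) ∉ B := Nat.findGreatest_of_ne_zero (P := fun x => (x, x) ∉ B) hgd.symm hg0
      have hgN : gd ≤ N - 1 := by rw [hgd]; exact Nat.findGreatest_le _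
      exact hPg (hBup _ hxx gd gd (by omega) (by omega) (le_refl _) hgN)
    · rintro ⟨hx1, hbx, hxN⟩
      by_contra hnot
      have := Nat.le_findGreatest (P := fun x => (x, x) ∉ B) hxN hnot
      rw [← hgd] at this
      omega
  · -- hBdom
    intro x
    constructor
    · intro hxx
      have hc := hBcell _ hxx
      simp only at hc
      refine ⟨hc.1, ?_, hc.2.2.1⟩
      by_contra hlt
      push Not at hlt
      have hg0 : gm ≠ 0 := by omega
      have hPg : (gm, gm + 1) ∉ B := Nat.findGreatest_of_ne_zero (P := fun x => (x, x + 1) ∉ B) hgm.symm hg0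
      have hgN : gm ≤ N - 2 := by rw [hgm]; exact Nat.findGreatest_le _
      exact hPg (hBup _ hxx gm (gm + 1) (by omega) (by omega) (by omega) (by omega))
    · rintro ⟨hx1, hbx, hxN⟩
      by_contra hnot
      have := Nat.le_findGreatest (P := fun x => (x, x + 1) ∉ B) (by omega : x ≤ N - 2) hnot
      rw [← hgm] at this
      omega
  · -- hbd : db ≤ bd ∧ bd ≤ db + 1
    constructor
    · -- gm ≤ gd
      by_cases h0 : gm = 0
      · omega
      · have hPg : (gm, gm + 1) ∉ B := Nat.findGreatest_of_ne_zero (P := fun x => (x, x + 1) ∉ B) hgm.symm h0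
        have hgN : gm ≤ N - 2 := by rw [hgm]; exact Nat.findGreatest_le _
        have hdd : (gm, gm) ∉ B := fun h => hPg (hBup _ h gm (gm + 1) (le_refl _) (by omega) (by omega) (by omega))
        have := Nat.le_findGreatest (P := fun x => (x, x) ∉ B) (by omega : gm ≤ N - 1) hdd
        rw [← hgd] at this
        omega
    · -- gd ≤ gm + 1
      by_cases h0 : gd = 0
      · omega
      · have hPg : (gd, gd) ∉ B := Nat.findGreatest_of_ne_zero (P := fun x => (x, x) ∉ B) hgd.symm h0
        have hgN : gd ≤ N - 1 := by rw [hgd]; exact Nat.findGreatest_le _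
        by_cases h1 : gd = 1
        · omega
        · have hdm : (gd - 1, gd - 1 + 1) ∉ B := by
            have e : gd - 1 + 1 = gd := by omega
            rw [e]
            exact fun h => hPg (hBup _ h gd gd (by omega) (le_refl _) (le_refl _) hgN)
          have := Nat.le_findGreatest (P := fun x => (x, x + 1) ∉ B) (by omega : gd - 1 ≤ N - 2) hdm
          rw [← hgm] at this
          omega
  · omega
  · have : gm ≤ N - 2 := by rw [hgm]; exact Nat.findGreatest_le _
    omega
  · have : gd ≤ N - 1 := by rw [hgd]; exact Nat.findGreatest_le _
    omega
  · intro y; rw [hbeta]; omega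
  · -- hbetaP
    intro x hx1 hxN
    rw [hbetaP]
    constructor
    · have hnc : (x, x - 1) ∉ B := by
        intro h; have hc := hBcell _ h; simp only at hc; omega
      have := Nat.le_findGreatest (P := fun y => (x, y) ∉ B) (by omega : x - 1 ≤ N - 1) hnc
      omega
    · have := Nat.findGreatest_le (P := fun y => (x, y) ∉ B) (N - 1); omega

end Coefficientwise

end Summit.CriticalPhenomena.PercolationContinuityZ3.Theorems
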